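import Summits.BirchSwinnertonDyer.Rank1Residual.ManinAdditive.KatoCurvePlusDefectProofs
import HarnessLib
import HarnessLib.Audit.Tags

/-!
# The LEVERS at `p = 3` and `p = 2`: one-sided witness transfer along `Ω(W) ∣_p Ω(E_K)`, Kato's fact at `E_K` ⟹
# `p ∤ c₀` — the corollaries of E-es-63, PROVED (cell `bsd-f2-manin`, es g16/g17 §2 VERBATIM; T-es-20 (c) / T-es-21 (ii))

Sorry-free, VERBATIM from HOME/es/Sketch-es-g17.lean 93557c1a115c1402 §2 (refuter-1 §R60: re-checked), re-keyed to
the leaf `KatoCurvePlusDefect.lean`, the proofs sibling `KatoCurvePlusDefectProofs.lean` and the Literature facts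
F-es-18♭K / F-es-21♭K (`kato_isIntegral_twistedSymbolSum_{three,two}_symbolClosure`,
`Literature/NumberTheory/EllipticCurves/KatoAdditiveTwistedValueNeronIntegralitySymbolClosure.lean`).  Contents:
`cuspidalPlusDefectPrimeTo_three_iff` (g17 projection form ⟺ g16 intersection form at `p = 3`),
`threeAdicPolarWitness_of_periodDividesAt` / `twoAdicPolarWitness_of_periodDividesAt` (ONE-SIDED transfer),
`not_three_dvd_of_katoFactThreeAt_of_witness` / `not_two_dvd_of_katoFactTwoAt_of_witness` (the g16 / g14 LEVER),
**`not_three_dvd_maninConstant_of_noPlusDefect`** (F-es-18♭K → E-es-61 → E-es-63 → lattice-optimal, `9 ∣ N`, no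
rational `3`-torsion, `pd₃ = 0`, `E_K` side conditions → `3 ∤ c`), `…_of_realPartPrimeToThree`,
**`not_three_dvd_maninConstant_of_noPlusDefect'`** (E-es-63 discharged), the law-free `p = 2` twins
`not_two_dvd_maninConstant_of_noPlusDefect_of_witness` / `…'`.  NOT here (route cone): the stub-shape corollaries
`…_of_noPlusDefect_stub` which discharge the three `E_K` side conditions by `IsNewformOf.of_isIsogenous`,
`ManinLocalTwoThree.not_good_and_not_mult_of_sq_dvd_level` (imports the route file) and `IsIsogenous.LFunction_eq` —
hand-over HOME/typer/ManinLocalTwoThreeKatoCurveNoPlusDefectStub.handover.lean to the C3 lead (`Theorems/`).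
CONDITIONAL edges (hypotheses F-es-18♭K / F-es-21♭K are Literature facts, E-es-61 a law, `E_K` data per class);
nothing about BSD or Manin's conjecture is proved.
-/

set_option autoImplicit false

noncomputable section

open scoped Classical MatrixGroups ModularForm ComplexConjugate

open CongruenceSubgroup Complex WeierstrassCurve Literature.NumberTheory.EllipticCurves
  Literature.NumberTheory.EllipticCurves.ModularForms

namespace Summit.BirchSwinnertonDyer.Rank1Residual.ManinAdditive.KatoCurve

open Summit.BirchSwinnertonDyer.Rank1Residual.ManinAdditive.CuspidalKummer
  Summit.BirchSwinnertonDyer.Rank1Residual.ManinAdditive.CuspidalKummerThree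

variable {W : WeierstrassCurve ℚ} {N : ℕ} [NeZero N]

/-- At `p = 3` (odd) the plus-defect predicate IS g16's intersection-form invariant. -/
theorem cuspidalPlusDefectPrimeTo_three_iff (D : ModularParametrizationData W N) :
    CuspidalPlusDefectPrimeTo 3 D ↔ CuspidalRealPartPrimeToThree D := by
  constructor
  · intro h x hx
    obtain ⟨n, hn, y, hy, hxy⟩ := h (x : ℂ) hx
    refine ⟨2 * n, ?_, ?_⟩
    · intro h3
      rcases (Nat.Prime.dvd_mul Nat.prime_three).mp h3 with h3 | h3
      · omega
      · exact hn h3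
    · have hrew : ((((2 * n : ℕ) : ℝ) * x : ℝ) : ℂ) = (n : ℂ) * ((x : ℂ) + conj (x : ℂ)) := by
        rw [Complex.conj_ofReal]; push_cast; ring
      rw [hrew, hxy]
      exact add_mem hy (conj_mem_periodLattice' D hy)
  · intro h x hx
    have hreal : x + conj x = (((2 * x.re : ℝ)) : ℂ) := by
      rw [Complex.add_conj]
    have hmem : (((2 * x.re : ℝ)) : ℂ) ∈ AddSubgroup.closure (Set.range (modularSymbol D.f)) := by
      rw [← hreal]; exact add_mem hx (conj_mem_symbolClosure D hx)
    obtain ⟨n, hn, hy⟩ := h (2 * x.re) hmem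
    refine ⟨2 * n, ?_, _, hy, ?_⟩
    · intro h3
      rcases (Nat.Prime.dvd_mul Nat.prime_three).mp h3 with h3 | h3
      · omega
      · exact hn h3
    · rw [hreal, Complex.conj_ofReal]; push_cast; ring


/-- ONE-SIDED TRANSFER at `p = 3`: a 3-adic polar witness against `Ω(V₁)` is one against `Ω(V₂)` as soon as
`Ω(V₁) ∣₃ Ω(V₂)` (no 3-adic EQUIVALENCE needed: dividing the relevant quantity by a 3-adic integer keeps it
non-integral after clearing the prime-to-3 part). -/
theorem threeAdicPolarWitness_of_periodDividesAt
    (W V₂ V₁ : WeierstrassCurve ℚ) [V₂.IsElliptic] [V₁.IsElliptic] (f : CuspForm (Gamma0 N) 2)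
    (hwit : ThreeAdicPolarWitness W V₁ f) (hdvd : PeriodDividesAt 3 V₂ V₁)
    (hnew : IsNewformOf V₂ f) (hg : ¬ V₂.HasGoodReductionAtPrime 3)
    (hm : ¬ V₂.HasMultiplicativeReductionAtPrime 3)
    (ha : ∀ ℓ : ℕ, V₂.LFunction ℓ = V₁.LFunction ℓ) :
    ThreeAdicPolarWitness W V₂ f := by
  obtain ⟨m, hm0, χ, r, ρ, _hnew, _hg, _hm, hcop, hprim, hne, hord, h3a, h3b, hev, hρ, hsum, hwit⟩ := hwit
  obtain ⟨k, d, hk, hd3, hkd⟩ := hdvd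
  have hkne : k ≠ 0 := Nat.pos_iff_ne_zero.mp hk
  have hk0 : (k : ℝ) ≠ 0 := by exact_mod_cast hkne
  have hkC : (k : ℂ) ≠ 0 := by exact_mod_cast hkne
  refine ⟨m, hm0, χ, r, ρ * d / k, hnew, hg, hm, hcop, hprim, hne, hord, h3a, h3b, hev, ?_, ?_, ?_⟩
  · rw [← hρ]
    have hV₁ : V₁.realPeriodRat = (d : ℝ) * V₂.realPeriodRat / k := by
      rw [eq_div_iff hk0]; linarith [hkd]
    rw [hV₁]; push_cast; ring
  · simpa [ha] using hsum
  · intro s hs hint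
    have hsd : ¬ 3 ∣ s * d := by
      intro h
      rcases (Nat.Prime.dvd_mul Nat.prime_three).mp h with h | h
      · exact hs h
      · exact hd3 h
    apply hwit (s * d) hsd
    have key : (((s * d : ℕ)) : ℂ) * r * (ρ : ℂ) / 3 =
        ((k : ℤ) : ℂ) * ((s : ℂ) * r * ((ρ * d / k : ℚ) : ℂ) / 3) := by
      push_cast
      field_simp
    rw [key]
    exact (isIntegral_algebraMap (R := ℤ) (A := ℂ) (x := (k : ℤ))).mul hint

/-- g16's LEVER at `p = 3` (verbatim proof). -/
theorem not_three_dvd_of_katoFactThreeAt_of_witness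
    (W V : WeierstrassCurve ℚ) [V.IsElliptic] [V.IsGloballyMinimal]
    (f : CuspForm (Gamma0 N) 2) (c : ℤ)
    (hF : KatoFactThreeAt V f) (hW : ThreeAdicPolarWitness W V f)
    (hΩ : W.realPeriodRat = (c : ℝ) * plusPeriod f) (hc0 : c ≠ 0) :
    ¬ 3 ∣ c := by
  rintro ⟨c', rfl⟩
  obtain ⟨m, _, χ, r, ρ, hnew, hg, hm, hcop, hprim, hne, hord, h3a, h3b, hev, hρ, hsum, hwit⟩ := hW
  have hc : (((3 * c' : ℤ)) : ℝ) ≠ 0 := by exact_mod_cast hc0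
  have hc' : (c' : ℂ) ≠ 0 := by
    have h3 : (3 * c' : ℤ) ≠ 0 := hc0
    exact_mod_cast (mul_ne_zero_iff.mp h3).2
  have hpp : (plusPeriod f : ℝ) = (ρ : ℝ) * V.realPeriodRat / ((3 * c' : ℤ) : ℝ) := by
    rw [eq_div_iff hc, hρ, hΩ]; ring
  set ϖ : ℚ := ρ / ((3 * c' : ℤ) : ℚ) with hϖ
  have hϖΩ : (ϖ : ℝ) * V.realPeriodRat = plusPeriod f := by
    rw [hpp, hϖ]; push_cast; ring
  obtain ⟨s, hs, hint⟩ := (hF hnew hg hm m hcop χ hprim hne hord h3a h3b ϖ r).1 hev hϖΩ hsum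
  apply hwit s hs
  have key : (s : ℂ) * r * (ρ : ℂ) / 3 = (c' : ℂ) * ((s : ℂ) * (ϖ : ℂ) * r) := by
    rw [hϖ]; push_cast
    field_simp
  rw [key]
  exact (isIntegral_algebraMap (R := ℤ) (A := ℂ) (x := c')).mul hint

/-- **COROLLARY′ (g17; one law FEWER than g16's `not_three_dvd_maninConstant_of_nonRealCuspidal`).**  F-es-18♭K +
the unit-witness law E-es-61 + the SUPPORT E-es-63 (provable) give `3 ∤ c₀` for every lattice-optimal `W` with
`9 ∣ N`, no rational point of order `3` and cuspidal group of plus-defect prime to `3` (= real part prime to `3`). -/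
theorem not_three_dvd_maninConstant_of_noPlusDefect
    (hF : kato_isIntegral_twistedSymbolSum_three_symbolClosure)
    (h61 : ThreeAdicUnitWitnessOfNoRationalThreeTorsion) (h63 : KatoCurvePeriodDvdOfNoPlusDefect)
    (W : WeierstrassCurve ℚ) [W.IsElliptic] [W.IsGloballyMinimal]
    (D : ModularParametrizationData W N)
    (hopt : ∀ z ∈ D.L.lattice, ∃ w ∈ periodLattice D.f, z = D.c * w) (h9 : 3 ^ 2 ∣ N)
    (hT : ∀ X₀ Y₀ : ℚ, ¬ IsShortThreeTorsion W D.c X₀ Y₀) (hpd : CuspidalPlusDefectPrimeTo 3 D)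
    (VK : WeierstrassCurve ℚ) [VK.IsElliptic] [VK.IsGloballyMinimal]
    (hiso : IsIsogenous W VK) (hK : IsSymbolClosureCurve VK D.f)
    (hnewK : IsNewformOf VK D.f) (hgK : ¬ VK.HasGoodReductionAtPrime 3)
    (hmK : ¬ VK.HasMultiplicativeReductionAtPrime 3) (haK : ∀ ℓ : ℕ, VK.LFunction ℓ = W.LFunction ℓ) :
    ¬ (3 : ℤ) ∣ D.c := by
  have hwit : ThreeAdicPolarWitness W VK D.f :=
    threeAdicPolarWitness_of_periodDividesAt W VK W D.f (h61 W D hopt h9 hT)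
      (h63 3 W D hopt hpd VK hiso hK) hnewK hgK hmK haK
  have hFact : KatoFactThreeAt VK D.f := hF VK D.f hK
  have hΩ : W.realPeriodRat = ((|D.c| : ℤ) : ℝ) * plusPeriod D.f := by
    rw [Int.cast_abs]; exact D.realPeriodRat_eq_abs_mul_plusPeriod_of_latticeEq hopt
  have hc0 : D.c ≠ 0 := D.maninConstant_ne_zero_holds
  have h := not_three_dvd_of_katoFactThreeAt_of_witness W VK D.f |D.c| hFact hwit hΩ (abs_ne_zero.mpr hc0)
  exact fun h3 => h ((dvd_abs 3 D.c).mpr h3)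

/-- The same corollary with g16's intersection-form hypothesis (via `cuspidalPlusDefectPrimeTo_three_iff`). -/
theorem not_three_dvd_maninConstant_of_realPartPrimeToThree
    (hF : kato_isIntegral_twistedSymbolSum_three_symbolClosure)
    (h61 : ThreeAdicUnitWitnessOfNoRationalThreeTorsion) (h63 : KatoCurvePeriodDvdOfNoPlusDefect)
    (W : WeierstrassCurve ℚ) [W.IsElliptic] [W.IsGloballyMinimal]
    (D : ModularParametrizationData W N)
    (hopt : ∀ z ∈ D.L.lattice, ∃ w ∈ periodLattice D.f, z = D.c * w) (h9 : 3 ^ 2 ∣ N)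
    (hT : ∀ X₀ Y₀ : ℚ, ¬ IsShortThreeTorsion W D.c X₀ Y₀) (hreal : CuspidalRealPartPrimeToThree D)
    (VK : WeierstrassCurve ℚ) [VK.IsElliptic] [VK.IsGloballyMinimal]
    (hiso : IsIsogenous W VK) (hK : IsSymbolClosureCurve VK D.f)
    (hnewK : IsNewformOf VK D.f) (hgK : ¬ VK.HasGoodReductionAtPrime 3)
    (hmK : ¬ VK.HasMultiplicativeReductionAtPrime 3) (haK : ∀ ℓ : ℕ, VK.LFunction ℓ = W.LFunction ℓ) :
    ¬ (3 : ℤ) ∣ D.c :=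
  not_three_dvd_maninConstant_of_noPlusDefect hF h61 h63 W D hopt h9 hT
    ((cuspidalPlusDefectPrimeTo_three_iff D).mpr hreal) VK hiso hK hnewK hgK hmK haK

/-- ONE-SIDED TRANSFER at `p = 2`. -/
theorem twoAdicPolarWitness_of_periodDividesAt
    (W V₂ V₁ : WeierstrassCurve ℚ) [V₂.IsElliptic] [V₁.IsElliptic] (f : CuspForm (Gamma0 N) 2)
    (hwit : TwoAdicPolarWitness W V₁ f) (hdvd : PeriodDividesAt 2 V₂ V₁)
    (hnew : IsNewformOf V₂ f) (hg : ¬ V₂.HasGoodReductionAtPrime 2)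
    (hm : ¬ V₂.HasMultiplicativeReductionAtPrime 2)
    (ha : ∀ ℓ : ℕ, V₂.LFunction ℓ = V₁.LFunction ℓ) :
    TwoAdicPolarWitness W V₂ f := by
  obtain ⟨m, hm0, χ, r, ρ, _hnew, _hg, _hm, hcop, hprim, hne, hodd, h8, hρ, hsum, hwit⟩ := hwit
  obtain ⟨k, d, hk, hd2, hkd⟩ := hdvd
  have hkne : k ≠ 0 := Nat.pos_iff_ne_zero.mp hk
  have hk0 : (k : ℝ) ≠ 0 := by exact_mod_cast hkne
  have hkC : (k : ℂ) ≠ 0 := by exact_mod_cast hkne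
  refine ⟨m, hm0, χ, r, ρ * d / k, hnew, hg, hm, hcop, hprim, hne, hodd, h8, ?_, ?_, ?_⟩
  · rw [← hρ]
    have hV₁ : V₁.realPeriodRat = (d : ℝ) * V₂.realPeriodRat / k := by
      rw [eq_div_iff hk0]; linarith [hkd]
    rw [hV₁]; push_cast; ring
  · simpa [ha] using hsum
  · intro s hs hint
    have hsd : ¬ 2 ∣ s * d := by
      intro h
      rcases (Nat.Prime.dvd_mul Nat.prime_two).mp h with h | h
      · exact hs h
      · exact hd2 h
    apply hwit (s * d) hsd
    have key : (((s * d : ℕ)) : ℂ) * r * (ρ : ℂ) / 2 =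
        ((k : ℤ) : ℂ) * ((s : ℂ) * r * ((ρ * d / k : ℚ) : ℂ) / 2) := by
      push_cast
      field_simp
    rw [key]
    exact (isIntegral_algebraMap (R := ℤ) (A := ℂ) (x := (k : ℤ))).mul hint

/-- g14's LEVER at `p = 2` (verbatim proof). -/
theorem not_two_dvd_of_katoFactTwoAt_of_witness
    (W V : WeierstrassCurve ℚ) [V.IsElliptic] [V.IsGloballyMinimal]
    (f : CuspForm (Gamma0 N) 2) (c : ℤ)
    (hF : KatoFactTwoAt V f) (hW : TwoAdicPolarWitness W V f)
    (hΩ : W.realPeriodRat = (c : ℝ) * plusPeriod f) (hc0 : c ≠ 0) :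
    ¬ 2 ∣ c := by
  rintro ⟨c', rfl⟩
  obtain ⟨m, _, χ, r, ρ, hnew, hg, hm, hcop, hprim, hne, hodd, h8, hρ, hsum, hwit⟩ := hW
  have hc : (((2 * c' : ℤ)) : ℝ) ≠ 0 := by exact_mod_cast hc0
  have hc' : (c' : ℂ) ≠ 0 := by
    have h2 : (2 * c' : ℤ) ≠ 0 := hc0
    exact_mod_cast (mul_ne_zero_iff.mp h2).2
  have hpp : (plusPeriod f : ℝ) = (ρ : ℝ) * V.realPeriodRat / ((2 * c' : ℤ) : ℝ) := by
    rw [eq_div_iff hc, hρ, hΩ]; ring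
  set ϖ : ℚ := ρ / ((2 * c' : ℤ) : ℚ) with hϖ
  have hϖΩ : (ϖ : ℝ) * V.realPeriodRat = plusPeriod f := by
    rw [hpp, hϖ]; push_cast; ring
  obtain ⟨s, hs, hint⟩ := hF hnew hg hm m hcop χ hprim hne hodd h8 ϖ r hϖΩ hsum
  apply hwit s hs
  have key : (s : ℂ) * r * (ρ : ℂ) / 2 = (c' : ℂ) * ((s : ℂ) * (ϖ : ℂ) * r) := by
    rw [hϖ]; push_cast
    field_simp
  rw [key]
  exact (isIntegral_algebraMap (R := ℤ) (A := ℂ) (x := c')).mul hint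

/-- **COROLLARY at `p = 2` (law-free bookkeeping).**  F-es-21♭K + the support E-es-63 + a 2-adic-unit even polar
witness against `Ω(W)` (a per-class HYPOTHESIS: E27's `g₁ = 0`) give `2 ∤ c₀` on every lattice-optimal `W` whose
cuspidal group has plus-defect prime to `2` (E39: 219/277 optimal classes `N ≤ 360`), granted Kato's curve `VK`. -/
theorem not_two_dvd_maninConstant_of_noPlusDefect_of_witness
    (hF : kato_isIntegral_twistedSymbolSum_two_symbolClosure) (h63 : KatoCurvePeriodDvdOfNoPlusDefect)
    (W : WeierstrassCurve ℚ) [W.IsElliptic] [W.IsGloballyMinimal]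
    (D : ModularParametrizationData W N)
    (hopt : ∀ z ∈ D.L.lattice, ∃ w ∈ periodLattice D.f, z = D.c * w)
    (hpd : CuspidalPlusDefectPrimeTo 2 D) (hwitW : TwoAdicPolarWitness W W D.f)
    (VK : WeierstrassCurve ℚ) [VK.IsElliptic] [VK.IsGloballyMinimal]
    (hiso : IsIsogenous W VK) (hK : IsSymbolClosureCurve VK D.f)
    (hnewK : IsNewformOf VK D.f) (hgK : ¬ VK.HasGoodReductionAtPrime 2)
    (hmK : ¬ VK.HasMultiplicativeReductionAtPrime 2) (haK : ∀ ℓ : ℕ, VK.LFunction ℓ = W.LFunction ℓ) :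
    ¬ (2 : ℤ) ∣ D.c := by
  have hwit : TwoAdicPolarWitness W VK D.f :=
    twoAdicPolarWitness_of_periodDividesAt W VK W D.f hwitW (h63 2 W D hopt hpd VK hiso hK) hnewK hgK hmK haK
  have hFact : KatoFactTwoAt VK D.f := hF VK D.f hK
  have hΩ : W.realPeriodRat = ((|D.c| : ℤ) : ℝ) * plusPeriod D.f := by
    rw [Int.cast_abs]; exact D.realPeriodRat_eq_abs_mul_plusPeriod_of_latticeEq hopt
  have hc0 : D.c ≠ 0 := D.maninConstant_ne_zero_holds
  have h := not_two_dvd_of_katoFactTwoAt_of_witness W VK D.f |D.c| hFact hwit hΩ (abs_ne_zero.mpr hc0)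
  exact fun h2 => h ((dvd_abs 2 D.c).mpr h2)

/-- **FINAL FORM at `p = 3` (E-es-63 discharged by `katoCurvePeriodDvdOfNoPlusDefect_holds`): the non-real-cuspidal
part of RES₃′ from F-es-18♭K + ONE law (E-es-61) + the `VK` supports.** -/
theorem not_three_dvd_maninConstant_of_noPlusDefect'
    (hF : kato_isIntegral_twistedSymbolSum_three_symbolClosure)
    (h61 : ThreeAdicUnitWitnessOfNoRationalThreeTorsion)
    (W : WeierstrassCurve ℚ) [W.IsElliptic] [W.IsGloballyMinimal]
    (D : ModularParametrizationData W N)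
    (hopt : ∀ z ∈ D.L.lattice, ∃ w ∈ periodLattice D.f, z = D.c * w) (h9 : 3 ^ 2 ∣ N)
    (hT : ∀ X₀ Y₀ : ℚ, ¬ IsShortThreeTorsion W D.c X₀ Y₀) (hpd : CuspidalPlusDefectPrimeTo 3 D)
    (VK : WeierstrassCurve ℚ) [VK.IsElliptic] [VK.IsGloballyMinimal]
    (hiso : IsIsogenous W VK) (hK : IsSymbolClosureCurve VK D.f)
    (hnewK : IsNewformOf VK D.f) (hgK : ¬ VK.HasGoodReductionAtPrime 3)
    (hmK : ¬ VK.HasMultiplicativeReductionAtPrime 3) (haK : ∀ ℓ : ℕ, VK.LFunction ℓ = W.LFunction ℓ) :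
    ¬ (3 : ℤ) ∣ D.c :=
  not_three_dvd_maninConstant_of_noPlusDefect hF h61 katoCurvePeriodDvdOfNoPlusDefect_holds W D hopt h9 hT hpd
    VK hiso hK hnewK hgK hmK haK

/-- **FINAL FORM at `p = 2`** (law-free: F-es-21♭K + a per-class unit witness against `Ω(W)` + `pd₂ = 0`). -/
theorem not_two_dvd_maninConstant_of_noPlusDefect_of_witness'
    (hF : kato_isIntegral_twistedSymbolSum_two_symbolClosure)
    (W : WeierstrassCurve ℚ) [W.IsElliptic] [W.IsGloballyMinimal]
    (D : ModularParametrizationData W N)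
    (hopt : ∀ z ∈ D.L.lattice, ∃ w ∈ periodLattice D.f, z = D.c * w)
    (hpd : CuspidalPlusDefectPrimeTo 2 D) (hwitW : TwoAdicPolarWitness W W D.f)
    (VK : WeierstrassCurve ℚ) [VK.IsElliptic] [VK.IsGloballyMinimal]
    (hiso : IsIsogenous W VK) (hK : IsSymbolClosureCurve VK D.f)
    (hnewK : IsNewformOf VK D.f) (hgK : ¬ VK.HasGoodReductionAtPrime 2)
    (hmK : ¬ VK.HasMultiplicativeReductionAtPrime 2) (haK : ∀ ℓ : ℕ, VK.LFunction ℓ = W.LFunction ℓ) :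
    ¬ (2 : ℤ) ∣ D.c :=
  not_two_dvd_maninConstant_of_noPlusDefect_of_witness hF katoCurvePeriodDvdOfNoPlusDefect_holds W D hopt hpd hwitW
    VK hiso hK hnewK hgK hmK haK

end Summit.BirchSwinnertonDyer.Rank1Residual.ManinAdditive.KatoCurve

end
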